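import Literature.NumberTheory.EllipticCurves.FunctionFieldUnramified
import Literature.NumberTheory.GaloisRepresentations.IntegralGaloisActionProofs
import Literature.NumberTheory.GaloisRepresentations.AbsGaloisGroupCompact
import Mathlib.FieldTheory.PurelyInseparable.PerfectClosure
import HarnessLib

/-!
# `Gal(F̄/F)` acts transitively on the primes of `\bar O_v` above a place — in every characteristic

`Proofs` companion of `Literature/NumberTheory/EllipticCurves/FunctionFieldUnramified.lean`
(provefact seat on `FunctionField.finite_shaPrimeToChar_torsionBy`, bsd.S33). For a place `v`
of a field `F` (a discrete valuation ring `O_v = v.1 ⊆ F`), the file `FunctionFieldUnramified`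
introduced `Place.primesAbove v`, the primes of the ring of absolute integers
`\bar O_v = Literature.absIntegers O_v F = integralClosure O_v F̄` above `𝔪_v`; the unramified classes
`H¹(G_F, M; S)` are cut out by the inertia groups of *all* these primes. Both steps of the
Selmer finiteness over a global function field (Silverman, *AEC*, X.4.3 and X.4.4; Milne, *ADT*,
I.4.15 and I.6.5) need that these primes — equivalently the extensions of `v` to `F̄` — are
**conjugate under `Γ_F = Gal(F̄/F)`** (Neukirch, *Algebraic Number Theory*, Ch. I §9, Prop. (9.1)
at finite level, Ch. II §8 (8.1)/§9 for `K̄`; Silverman, *AEC*, VIII.§2, the remark that being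
unramified at `v` does not depend on the extension of `v` to `K̄`). For number fields the tree
proves this in `IntegralGaloisActionProofs` (`exists_smul_eq_of_mem_primesAbove_holds`) from
Mathlib's profinite transitivity theorem `Algebra.IsInvariant.exists_smul_of_under_eq_of_profinite`,
using `\bar ℤ_K^{Γ_K} = 𝓞 K` — which needs `K̄/K` Galois, i.e. **characteristic `0`**
(`absIntegers.isInvariant` carries `[CharZero K]`). Over a function field of characteristic `p`,
`F̄/F` is not separable and `\bar O_v^{Γ_F}` is the integral closure of `O_v` in the perfect
closure `F^{perf} = F̄^{Γ_F}`, strictly bigger than `O_v`. This file proves the transitivity in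
**every characteristic**:

* `Literature.NumberTheory.EllipticCurves.FunctionField.mem_perfectClosure_of_forall_algEquiv_apply_eq`:
  an element of `F̄` fixed by every `F`-automorphism lies in the perfect closure of `F` (all roots
  of its minimal polynomial are conjugate to it, `Normal.minpoly_eq_iff_mem_orbit`, hence equal to
  it, so the separable degree is `1`, `mem_perfectClosure_iff_natSepDegree_eq_one`);
* `Place.mem_iff_mem_of_forall_smul_eq`: a `Γ_F`-fixed absolute integer `b` lies in a prime
  `𝔓 ∣ 𝔪_v` iff it lies in any other prime `𝔓' ∣ 𝔪_v`: some power `b^{q^n}` (`q` the exponential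
  characteristic) comes from `F`, hence from `O_v` (integrally closed), and
  `b ∈ 𝔓 ⇔ b^{q^n} ∈ 𝔓 ⇔ b^{q^n} ∈ 𝔪_v`;
* `Place.exists_smul_eq_of_mem_primesAbove` (**Neukirch I (9.1) for `F̄/F`, any characteristic**):
  for `𝔓, 𝔓' ∈ v.primesAbove` there is `σ ∈ Γ_F` with `σ • 𝔓 = 𝔓'` — Mathlib's profinite
  transitivity applied to the base ring `A₀ = \bar O_v^{Γ_F}` (`FixedPoints.subring`, for which
  `Algebra.IsInvariant` is tautological), over which `𝔓` and `𝔓'` lie over the same prime by the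
  previous item; `Γ_F` is compact in every characteristic (`absoluteGaloisGroup_compactSpace`,
  `AbsGaloisGroupCompact`) and acts continuously on the discrete ring `\bar O_v`
  (`absIntegers.continuousSMul`).
* Consequence for the unramified classes: `Place.unramifiedKer_smul`
  (`σ • 𝔓` has inertia group `σ I_𝔓 σ⁻¹`) is *not* needed here and not proved; what the Selmer
  files use is the transitivity itself.

## References

* [NeukirchANT1999] J. Neukirch, *Algebraic Number Theory*, Springer 1999, Ch. I §9 Prop. (9.1)
  (transitivity on primes above, finite Galois level), Ch. II §8 (8.1) (extensions of valuations
  to algebraic extensions are conjugate).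
* [SilvermanAEC2009] J. H. Silverman, *The Arithmetic of Elliptic Curves*, 2nd ed., VIII.§2
  (Definition of unramified classes, independence of the extension of `v`).
* J. S. Milne, *Fields and Galois Theory*, Ch. 7 (the fixed field of `Aut(F̄/F)` is the perfect
  closure).

## Mathlib reuse

`Algebra.IsInvariant.exists_smul_of_under_eq_of_profinite`, `FixedPoints.subring`,
`Normal.minpoly_eq_iff_mem_orbit`, `Polynomial.natSepDegree_eq_of_isAlgClosed`,
`mem_perfectClosure_iff_natSepDegree_eq_one`, `mem_perfectClosure_iff_pow_mem`,
`IsIntegrallyClosed.algebraMap_eq_of_integral`; from the tree: `absIntegers.continuousSMul`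
(`IntegralGaloisActionProofs`), `absoluteGaloisGroup_compactSpace` (`AbsGaloisGroupCompact`),
`Place.primesAbove` (`FunctionFieldUnramified`).
-/

noncomputable section

open scoped Classical Polynomial Pointwise

namespace Literature.NumberTheory.EllipticCurves.FunctionField

open Literature.NumberTheory.GaloisRepresentations Field IntermediateField

/-! ## The fixed field of `Aut(F̄/F)` lies in the perfect closure -/

/-- **An element of `F̄` fixed by all `F`-automorphisms is purely inseparable over `F`** (lies in
the perfect closure `perfectClosure F F̄`): every root in `F̄` of its minimal polynomial is
conjugate to it under `Aut(F̄/F)` (`F̄/F` is normal; `Normal.minpoly_eq_iff_mem_orbit`), hence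
equal to it, so the minimal polynomial has exactly one distinct root and separable degree `1`.
Milne, *Fields and Galois Theory*, Ch. 7 (`F̄^{Aut(F̄/F)}` is the perfect closure of `F`).
[folklore] -/
theorem mem_perfectClosure_of_forall_algEquiv_apply_eq {F : Type*} [Field F]
    {x : AlgebraicClosure F}
    (hx : ∀ σ : AlgebraicClosure F ≃ₐ[F] AlgebraicClosure F, σ x = x) :
    x ∈ perfectClosure F (AlgebraicClosure F) := by
  classical
  have hint : IsIntegral F x := Algebra.IsIntegral.isIntegral x
  rw [mem_perfectClosure_iff_natSepDegree_eq_one,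
    Polynomial.natSepDegree_eq_of_isAlgClosed (AlgebraicClosure F)]
  have hroots : ((minpoly F x).aroots (AlgebraicClosure F)).toFinset = {x} := by
    ext y
    simp only [Multiset.mem_toFinset, Finset.mem_singleton]
    constructor
    · intro hy
      rw [Polynomial.mem_aroots] at hy
      obtain ⟨-, hy⟩ := hy
      have hmin : minpoly F x = minpoly F y :=
        minpoly.eq_of_irreducible_of_monic (minpoly.irreducible hint) hy (minpoly.monic hint)
      obtain ⟨σ, hσ⟩ := (Normal.minpoly_eq_iff_mem_orbit (F := F) (AlgebraicClosure F)).mp hmin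
      change σ y = x at hσ
      calc y = σ.symm (σ y) := (σ.symm_apply_apply y).symm
        _ = σ.symm x := by rw [hσ]
        _ = x := hx σ.symm
    · intro hyx
      rw [hyx, Polynomial.mem_aroots]
      exact ⟨minpoly.ne_zero hint, minpoly.aeval F x⟩
  rw [hroots, Finset.card_singleton]

/-! ## Transitivity of `Γ_F` on the primes above a place -/

namespace Place

variable {F : Type} [Field F] (v : Place F)

/-- A `Γ_F`-fixed element of `\bar O_v` has a power `b ^ (q ^ n)` (`q` the exponential
characteristic of `F`) coming from `O_v`: it lies in the perfect closure of `F`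
(`mem_perfectClosure_of_forall_algEquiv_apply_eq`), and an element of `F` integral over the
integrally closed `O_v` lies in `O_v`. [folklore] -/
theorem exists_pow_eq_algebraMap_of_forall_smul_eq {b : absIntegers v.1 F}
    (hb : ∀ σ : absoluteGaloisGroup F, σ • b = b) :
    ∃ (n : ℕ) (a : v.1), b ^ (ringExpChar F) ^ n = algebraMap v.1 (absIntegers v.1 F) a := by
  have hx : ∀ σ : AlgebraicClosure F ≃ₐ[F] AlgebraicClosure F, σ (b : AlgebraicClosure F) = b := by
    intro σ
    have := congrArg Subtype.val (hb ((absoluteGaloisGroup.toAlgEquiv F).symm σ))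
    rwa [integralClosure.coe_smul, absoluteGaloisGroup.toAlgEquiv_symm_apply] at this
  obtain ⟨n, hn⟩ := mem_perfectClosure_iff.mp (mem_perfectClosure_of_forall_algEquiv_apply_eq hx)
  obtain ⟨y, hy⟩ := RingHom.mem_range.mp hn
  -- `y ∈ F` is integral over `O_v`, hence in `O_v`
  have hbn : IsIntegral v.1 ((b : AlgebraicClosure F) ^ (ringExpChar F) ^ n) := by
    have h := (mem_integralClosure_iff _ _).mp (b ^ (ringExpChar F) ^ n).2
    rwa [Subalgebra.coe_pow] at h
  rw [← hy] at hbn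
  have hyint : IsIntegral v.1 y :=
    (isIntegral_algebraMap_iff (algebraMap F (AlgebraicClosure F)).injective).mp hbn
  obtain ⟨a, rfl⟩ := IsIntegrallyClosed.algebraMap_eq_of_integral hyint
  refine ⟨n, a, Subtype.ext ?_⟩
  rw [Subalgebra.coe_pow, ← hy, Subalgebra.coe_algebraMap,
    IsScalarTower.algebraMap_apply v.1 F (AlgebraicClosure F)]

variable {v}

/-- **A `Γ_F`-fixed absolute integer lies in one prime above `𝔪_v` iff it lies in any other**:
with `b ^ (q ^ n) = a ∈ O_v` (`exists_pow_eq_algebraMap_of_forall_smul_eq`),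
`b ∈ 𝔓 ⇔ b ^ (q ^ n) ∈ 𝔓 ⇔ a ∈ 𝔓 ∩ O_v = 𝔪_v`, and the last condition does not mention `𝔓`.
(Over a perfect `F` this is the statement `𝔓 ∩ O_v = 𝔪_v = 𝔓' ∩ O_v`.) [folklore] -/
theorem mem_iff_mem_of_forall_smul_eq {𝔓 𝔓' : Ideal (absIntegers v.1 F)}
    (h𝔓 : 𝔓 ∈ v.primesAbove) (h𝔓' : 𝔓' ∈ v.primesAbove) {b : absIntegers v.1 F}
    (hb : ∀ σ : absoluteGaloisGroup F, σ • b = b) : b ∈ 𝔓 ↔ b ∈ 𝔓' := by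
  haveI := h𝔓.1
  haveI := h𝔓'.1
  obtain ⟨n, a, ha⟩ := exists_pow_eq_algebraMap_of_forall_smul_eq v hb
  have hq : 0 < (ringExpChar F) ^ n := pow_pos (expChar_pos F _) n
  have key : ∀ {Q : Ideal (absIntegers v.1 F)}, Q ∈ v.primesAbove →
      (b ∈ Q ↔ a ∈ IsLocalRing.maximalIdeal v.1) := by
    intro Q hQ
    haveI := hQ.1
    haveI := hQ.2
    rw [hQ.2.over, Ideal.under_def, Ideal.mem_comap, ← ha]
    exact ⟨fun h => Ideal.pow_mem_of_mem Q h _ hq, fun h => Ideal.IsPrime.mem_of_pow_mem ‹_› _ h⟩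
  rw [key h𝔓, key h𝔓']

variable (v)

/-- **`Gal(F̄/F)` acts transitively on the primes of `\bar O_v` above `𝔪_v`, in every
characteristic** (Neukirch, *ANT*, Ch. I §9 Prop. (9.1) at finite level, Ch. II (8.1) for the
extensions of `v` to `F̄`; the tree's `exists_smul_eq_of_mem_primesAbove_holds` is the
number-field case). Proof: Mathlib's profinite transitivity
`Algebra.IsInvariant.exists_smul_of_under_eq_of_profinite` for the compact
(`absoluteGaloisGroup_compactSpace`) totally disconnected group `Γ_F` acting continuously on the
discrete ring `\bar O_v` (`absIntegers.continuousSMul`), over the ring of invariants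
`A₀ = \bar O_v^{Γ_F}` (`FixedPoints.subring`, tautologically `Algebra.IsInvariant`), above whose
prime `𝔓 ∩ A₀ = 𝔓' ∩ A₀` (`mem_iff_mem_of_forall_smul_eq`) both primes lie.
[cite: NeukirchANT1999, Ch. I §9 Prop. (9.1)] -/
theorem exists_smul_eq_of_mem_primesAbove {𝔓 𝔓' : Ideal (absIntegers v.1 F)}
    (h𝔓 : 𝔓 ∈ v.primesAbove) (h𝔓' : 𝔓' ∈ v.primesAbove) :
    ∃ σ : absoluteGaloisGroup F, σ • 𝔓 = 𝔓' := by
  haveI := h𝔓.1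
  haveI := h𝔓'.1
  letI : TopologicalSpace (absIntegers v.1 F) := ⊥
  haveI : DiscreteTopology (absIntegers v.1 F) := ⟨rfl⟩
  haveI : ContinuousSMul (absoluteGaloisGroup F) (absIntegers v.1 F) :=
    absIntegers.continuousSMul v.1 (K := F)
  haveI : CompactSpace (absoluteGaloisGroup F) := absoluteGaloisGroup_compactSpace F
  let A₀ : Subring (absIntegers v.1 F) := FixedPoints.subring (absIntegers v.1 F) (absoluteGaloisGroup F)
  haveI : Algebra.IsInvariant A₀ (absIntegers v.1 F) (absoluteGaloisGroup F) :=
    ⟨fun b hb => ⟨⟨b, hb⟩, rfl⟩⟩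
  have hunder : 𝔓.under A₀ = 𝔓'.under A₀ := by
    ext ⟨b, hb⟩
    rw [Ideal.under_def, Ideal.under_def, Ideal.mem_comap, Ideal.mem_comap]
    exact mem_iff_mem_of_forall_smul_eq h𝔓 h𝔓' hb
  obtain ⟨σ, hσ⟩ := Algebra.IsInvariant.exists_smul_of_under_eq_of_profinite
    (A := A₀) (G := absoluteGaloisGroup F) 𝔓 𝔓' hunder
  exact ⟨σ, hσ.symm⟩

end Place

end Literature.NumberTheory.EllipticCurves.FunctionField

end
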